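import Literature.NumberTheory.Automorphic.AutomorphicRepsGLAnalyticVectors
import Literature.NumberTheory.Automorphic.ArchimedeanApplyFreeCongr
import Literature.NumberTheory.Automorphic.AutomorphicFormsL2DerivativeIntegral
import HarnessLib

/-!
# Nelson analyticity of `Δ`-finite vectors for a GENERAL automorphy datum

Topic `NumberTheory/Automorphic`; sequel of `AutomorphicRepsGLAnalyticVectors`, whose §1 (the Lie
derivatives as a Lie algebra representation on a `𝔤`-stable space `W` of smooth functions, the
skew-symmetry of the class-level Lie derivatives, Nelson's sum-of-squares estimate on a
finite-dimensional `Δ`-stable subspace, and the analyticity of the `L²`-orbits it implies) is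
stated there for an automorphy datum whose archimedean group is a FULL linear group
(`𝒟.arch.lie = ⊤`, `𝒟.arch.carrier = ⊤`, through `lieDeriv_bracket_of_top`). Since
`ArchimedeanApplyFreeCongr.lieDeriv_bracket` proves `[X, Y] φ = X (Y φ) - Y (X φ)` for EVERY linear
real group, the whole of §1 holds for every automorphy datum `𝒟` (finite-dimensional coefficient
algebra); this file records it, for use with archimedean groups such as `U(2,1) ≤ GL₃(ℂ)` which
are not full linear groups. Everything here is proved; there is NO definition: the Lie algebra
representation is packaged as an existence statement (`IsLieStableSmooth.exists_lieHom`) and the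
lemmas about it take a morphism `ρ : 𝔤 →ₗ⁅ℝ⁆ End_ℂ W` acting by Lie derivatives as a hypothesis.

* `IsLieStableSmooth.exists_lieHom` — `X ↦ (φ ↦ X φ)` is a morphism of real Lie algebras
  `𝔤 →ₗ⁅ℝ⁆ End_ℂ W` (any `𝒟`).
* `lieHom_sum_smul_eq`, `lieHom_mul_sub_mul_eq_sum`, `coe_lieHom_pow_apply`,
  `coe_sum_lieHom_mul_lieHom_apply` — real combinations, Nelson's bracket relations, powers.
* `IsL2LieStable.hasDerivAt_rightRegular_cl_lieHom` (`d/dt|₀ R(exp tX)[φ] = [X φ]`),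
  `IsL2LieStable.inner_cl_lieHom_add_inner_cl_lieHom` (skew-symmetry, `R` unitary),
  `IsL2LieStable.exists_norm_cl_lieHom_pow_le` (**Nelson's estimate**
  `‖[X^m φ]‖ ≤ (M ∑|xᵢ|)^m m! ‖[φ]‖` on a finite-dimensional `∑ᵢ Xᵢ²`-stable `T ≤ W`),
  `IsL2LieStable.analyticAt_rightRegular_cl_of_norm_lieHom_pow_le` (factorial bounds give
  analytic orbits).
* `IsL2LieStable.analyticAt_rightRegular_toLp_of_laplacian_stable` — **the statement consumed
  downstream, free of `ρ`**: if `X₁, …, X_d` span `𝔤` over `ℝ` and `V ≤ W` is a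
  finite-dimensional subspace with `∑ᵢ Xᵢ (Xᵢ ψ) ∈ V` for `ψ ∈ V`, then for every `f ∈ ℒ²(μ)` with
  `invQuot f ∈ V`, every `X ∈ 𝔤` and every `t₀`, the orbit `t ↦ R(exp tX) [f]` is real analytic
  at `t₀` (as a map into `L²(μ)`); `…_inner_…` the matrix-coefficient form
  `t ↦ ⟪u, R(exp tX) [f]⟫` (the hypothesis `hana` of
  `closure_l2OfForms_exp_invariant_of_analytic`).
* `IsL2LieStable.analyticAt_rightRegular_toLp_of_null` — **the Cauchy–Riemann route to
  `Δ`-stability**: if `𝔤` is spanned by `Y_a` (`a ∈ ι_K`) and pairs `P_b, Q_b` (`b ∈ ι_P`) with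
  `⁅P_b, Q_b⁆ ∈ span_ℝ {Y_a}`, and `V ≤ W` is finite-dimensional, stable under the `Y_a`, and
  ANNIHILATED by the `P_b - c⁻¹ Q_b` in the sense `Q_b ψ = c • P_b ψ` (`c² = -1`; for a Hermitian
  symmetric pair this says `𝔭⁻ V = 0`, resp. `𝔭⁺ V = 0`), then `V` is `Δ`-stable for
  `Δ = ∑ Y_a² + ∑ (P_b² + Q_b²)`, because `P² + Q² = (P - c⁻¹Q)∘… ` — precisely
  `P_b (P_b ψ) + Q_b (Q_b ψ) = -c • ⁅P_b, Q_b⁆ ψ` on `V` — so the orbits of `[f]`, `invQuot f ∈ V`,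
  are analytic. This replaces, for lowest-weight (holomorphic) vectors, the route through
  `Z(𝔤)`-finiteness and the Casimir element of the `GL_n` file.

## Proof sketch

As in `AutomorphicRepsGLAnalyticVectors` (Nelson 1959, §8; Harish-Chandra 1953, §7, §9, §11,
Lemma 34): the orbit of `[φ]` under `U(t) = R(exp tX)` has `L²`-derivative `[X φ]`
(`hasDerivAt_rightRegular_expMem_toLp`, no boundedness), the operators `φ ↦ Y φ` are skew for
`⟪[·], [·]⟫` and satisfy the bracket relations of `𝔤`, so Nelson's recursion
(`Literature.Analysis.OperatorTheory.norm_pow_sum_smul_le_of_laplacian_stable`) bounds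
`‖[X^m φ]‖` on a finite-dimensional `Δ`-stable `T`, and factorial bounds give analyticity
(`Literature.Analysis.OperatorTheory.analyticAt_oneParam_apply_of_norm_le`). For the
Cauchy–Riemann route: with `A = ρ P_b`, `B = ρ Q_b`, `B v = c A v` on `V` and `c² = -1`,
`B (B v) = c B (A v) = c (A (B v) - ⁅A, B⁆ v) = c² A (A v) - c ⁅A,B⁆ v`, so
`A² v + B² v = -c ρ⁅P_b, Q_b⁆ v ∈ V`.

## Design notes

* No definition: the representation `ρ` is obtained from `exists_lieHom` inside the proofs of
  the `ρ`-free statements; the class map `IsL2LieStable.cl` and the pulled-back inner product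
  `IsL2LieStable.innerCore` of the `GL_n` file are reused (they never needed `𝔤 = ⊤`).
* Hypotheses complete: `[FiniteDimensional ℝ A]` (for `lieDeriv_bracket` and smoothness of Lie
  derivatives), `[𝒢.IsAutomorphicMeasure μ]` (finite invariant measure, strongly continuous `R`).
* The datum `𝒟` enters only through `𝒟.arch` and `𝒟.ofArch` (and the continuity of the latter).

## References

* Harish-Chandra, *Representations of a semisimple Lie group on a Banach space. I*, Trans. AMS 75
  (1953), 185–243 (held): §7 (Thm. 2, pp. 209–210), §9 (p. 227), §11 (p. 230), Lemma 34 (p. 228)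
  [HarishChandraTAMS1953].
* E. Nelson, *Analytic vectors*, Ann. of Math. 70 (1959), 572–615, §2, §8 [Nelson1959] (not held).
* A. Borel, H. Jacquet, *Automorphic forms and automorphic representations*, Proc. Sympos. Pure
  Math. 33 (1979), Part 1, §1.5–1.6, 4.6 [BorelJacquetCorvallis1979].
* A. W. Knapp, *Representation Theory of Semisimple Groups* (1986), Ch. VIII §§2–3 (analyticity of
  `K`-finite vectors; lowest-weight vectors annihilated by `𝔭⁻`) [Knapp1986] (not held).
* B. C. Hall, *Lie Groups, Lie Algebras, and Representations*, 2nd ed., GTM 222 (2015) (held):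
  §10.2, proof of Prop. 10.6 (the Casimir on a highest weight vector) [Hall2015].
-/

-- Mathlib idiom (Mathlib/Algebra/Lie/OfAssociative.lean, where `LieRing.ofAssociativeRing` is a `def` made a
-- local instance file by file); needed to speak of `𝔤 →ₗ⁅ℝ⁆ Module.End ℂ W` and of `𝒟.arch.lie`
attribute [local instance 100] LieRing.ofAssociativeRing

open scoped MatrixGroups Matrix ContDiff Topology InnerProductSpace
open Filter UniversalEnvelopingAlgebra
open _root_.MeasureTheory

noncomputable section

namespace Literature.NumberTheory.Automorphic

variable {K : Type} [Field K] [NumberField K] {𝒢 : AdelicGroupData K}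
  {μ : Measure 𝒢.automorphicQuotient}
  {A : Type*} [NormedCommRing A] [NormedAlgebra ℝ A] [NormedAlgebra ℚ A] [CompleteSpace A]
  [StarRing A] {N : Type*} [Fintype N] [DecidableEq N]
  {𝒟 : AutomorphyDatum 𝒢 A N} {W : Submodule ℂ (𝒢.Adelic → ℂ)}

/-! ### 1. The Lie derivatives as a Lie algebra representation on `W` (any datum) -/

namespace IsLieStableSmooth

/-- **The Lie derivatives form a real Lie algebra representation of `𝔤` on `W`** for EVERY
automorphy datum (the archimedean group need not be a full linear group): there is a morphism of
real Lie algebras `ρ : 𝔤 →ₗ⁅ℝ⁆ End_ℂ W` with `ρ X φ = X φ` — `ℂ`-linear in `φ` (smoothness),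
`ℝ`-linear in `X`, compatible with brackets by `lieDeriv_bracket` (Goldfeld's
`D_α D_β - D_β D_α = D_{[α,β]}` for any linear real group). Harish-Chandra 1953, §7 (`π_W`);
Borel–Jacquet 1979, §1.5. [cite: HarishChandraTAMS1953, §7 (p. 209)] -/
theorem exists_lieHom [FiniteDimensional ℝ A] (h : IsLieStableSmooth 𝒟 W) :
    ∃ ρ : 𝒟.arch.lie →ₗ⁅ℝ⁆ Module.End ℂ W,
      ∀ (X : 𝒟.arch.lie) (φ : W), ((ρ X φ : W) : 𝒢.Adelic → ℂ) = lieDeriv 𝒟.ofArch X φ := by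
  let T : 𝒟.arch.lie → Module.End ℂ W := fun X ↦
    { toFun := fun φ ↦ ⟨lieDeriv 𝒟.ofArch X φ, h.lie_mem X φ φ.2⟩
      map_add' := fun φ ψ ↦ Subtype.ext
        (IsArchSmooth.lieDeriv_add 𝒟.ofArch X (h.smooth φ φ.2) (h.smooth ψ ψ.2))
      map_smul' := fun c φ ↦ Subtype.ext (lieDeriv_smul X c (φ : 𝒢.Adelic → ℂ)) }
  have hT : ∀ (X : 𝒟.arch.lie) (φ : W), ((T X φ : W) : 𝒢.Adelic → ℂ) = lieDeriv 𝒟.ofArch X φ :=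
    fun _ _ ↦ rfl
  refine ⟨{ toFun := T, map_add' := ?_, map_smul' := ?_, map_lie' := ?_ }, hT⟩
  · intro X Y
    refine LinearMap.ext fun φ ↦ Subtype.ext ?_
    rw [LinearMap.add_apply, Submodule.coe_add, hT, hT, hT]
    exact (h.smooth φ φ.2).lieDeriv_add_left 𝒟.ofArch X Y
  · intro a X
    refine LinearMap.ext fun φ ↦ Subtype.ext ?_
    rw [RingHom.id_apply, LinearMap.smul_apply, Submodule.coe_smul_of_tower, hT, hT,
      (h.smooth φ φ.2).lieDeriv_smul_left 𝒟.ofArch]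
  · intro X Y
    refine LinearMap.ext fun φ ↦ Subtype.ext ?_
    change lieDeriv 𝒟.ofArch ⁅X, Y⁆ φ = ((T X * T Y - T Y * T X) φ : W)
    rw [LinearMap.sub_apply, Submodule.coe_sub, Module.End.mul_apply, Module.End.mul_apply,
      hT, hT, hT, hT]
    exact lieDeriv_bracket 𝒟.ofArch X Y (h.smooth φ φ.2)

variable (h : IsLieStableSmooth 𝒟 W) (ρ : 𝒟.arch.lie →ₗ⁅ℝ⁆ Module.End ℂ W)
  (hρ : ∀ (X : 𝒟.arch.lie) (φ : W), ((ρ X φ : W) : 𝒢.Adelic → ℂ) = lieDeriv 𝒟.ofArch X φ)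
include h hρ

/-- Real linear combinations: `ρ (∑ xᵢ Xᵢ) = ∑ xᵢ ρ Xᵢ` with complex scalars on the right
(`ℝ`-linearity of the Lie derivative in `X`). Borel–Jacquet 1979, §1.5. [cite: BorelJacquet1979, §1.5] -/
theorem lieHom_sum_smul_eq {I : Type*} (s : Finset I) (x : I → ℝ) (X : I → 𝒟.arch.lie) :
    ρ (∑ i ∈ s, x i • X i) = ∑ i ∈ s, (x i : ℂ) • ρ (X i) := by
  refine LinearMap.ext fun φ ↦ Subtype.ext ?_
  rw [hρ, (h.smooth φ φ.2).lieDeriv_sum_smul_left 𝒟.ofArch, LinearMap.sum_apply,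
    Submodule.coe_sum]
  refine Finset.sum_congr rfl fun i _ ↦ ?_
  rw [LinearMap.smul_apply, Submodule.coe_smul, hρ, real_smul_fun_eq_coe_smul]

omit h in
/-- Brackets: if `⁅X i, X j⁆ = ∑ₗ c i j l • X l` then the operators `A_i = ρ (X i)` satisfy Nelson's
bracket relations `A_i A_j - A_j A_i = ∑ₗ c i j l • A_l` (Harish-Chandra 1953, §7: `π_W` is a
representation of `𝔤`; Nelson 1959, §8, hypothesis of Lemma 6.?). [cite: HarishChandraTAMS1953, §7 (p. 209)] -/
theorem lieHom_mul_sub_mul_eq_sum (h : IsLieStableSmooth 𝒟 W) {I : Type*} [Fintype I]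
    (X : I → 𝒟.arch.lie) (c : I → I → I → ℝ) (hbr : ∀ i j, ⁅X i, X j⁆ = ∑ l, c i j l • X l)
    (i j : I) :
    ρ (X i) * ρ (X j) - ρ (X j) * ρ (X i) = ∑ l, (c i j l : ℂ) • ρ (X l) := by
  calc ρ (X i) * ρ (X j) - ρ (X j) * ρ (X i) = ⁅ρ (X i), ρ (X j)⁆ :=
        (Ring.lie_def (ρ (X i)) (ρ (X j))).symm
    _ = ρ ⁅X i, X j⁆ := (LieHom.map_lie ρ _ _).symm
    _ = ∑ l, (c i j l : ℂ) • ρ (X l) := by rw [hbr, h.lieHom_sum_smul_eq ρ hρ]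

omit h in
/-- Powers: `((ρ X)^m φ : G(𝔸_K) → ℂ)` is the `m`-fold Lie derivative `X^m φ`. Borel–Jacquet 1979,
§1.5 (`U(𝔤)` acts by iterated Lie derivatives). [cite: BorelJacquet1979, §1.5] -/
theorem coe_lieHom_pow_apply (X : 𝒟.arch.lie) (m : ℕ) (φ : W) :
    (((ρ X ^ m) φ : W) : 𝒢.Adelic → ℂ) = iterLieDeriv 𝒟.ofArch (List.replicate m X) φ := by
  induction m with
  | zero => rfl
  | succ m ih =>
    rw [pow_succ', Module.End.mul_apply, hρ, ih, List.replicate_succ, iterLieDeriv_cons]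

omit h in
/-- Nelson's Laplacian `Δ = ∑ᵢ Xᵢ²` of a finite family unfolded:
`((∑ᵢ ρ Xᵢ ρ Xᵢ) φ : G(𝔸_K) → ℂ) = ∑ᵢ Xᵢ (Xᵢ φ)`. Nelson 1959, §8. [cite: Nelson1959, §8] -/
theorem coe_sum_lieHom_mul_lieHom_apply {I : Type*} [Fintype I] (X : I → 𝒟.arch.lie) (φ : W) :
    (((∑ i, ρ (X i) * ρ (X i)) φ : W) : 𝒢.Adelic → ℂ) =
      ∑ i, lieDeriv 𝒟.ofArch (X i) (lieDeriv 𝒟.ofArch (X i) φ) := by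
  rw [LinearMap.sum_apply, Submodule.coe_sum]
  refine Finset.sum_congr rfl fun i _ ↦ ?_
  rw [Module.End.mul_apply, hρ, hρ]

end IsLieStableSmooth

/-! ### 2. Class-level Lie derivatives on an `L²`-Lie-stable space: skew-symmetry, Nelson's
estimate, analytic orbits (any datum) -/

namespace IsL2LieStable

variable (h : IsL2LieStable 𝒟 μ W) (ρ : 𝒟.arch.lie →ₗ⁅ℝ⁆ Module.End ℂ W)
  (hρ : ∀ (X : 𝒟.arch.lie) (φ : W), ((ρ X φ : W) : 𝒢.Adelic → ℂ) = lieDeriv 𝒟.ofArch X φ)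
include h hρ

variable [𝒢.IsAutomorphicMeasure μ]

/-- **The `L²`-derivative of the orbit of a class is the class of the Lie derivative** (any
datum): `d/dt|₀ R(exp tX) [φ] = [X φ]` for `φ ∈ W` (`hasDerivAt_rightRegular_expMem_toLp`).
Harish-Chandra 1953, §9 (p. 227); Getz–Hahn 2024, Def. 4.5 (b). [cite: HarishChandraTAMS1953, §9 (p. 227)] -/
theorem hasDerivAt_rightRegular_cl_lieHom (X : 𝒟.arch.lie) (φ : W) :
    HasDerivAt (fun t : ℝ ↦ 𝒢.rightRegular μ (𝒟.ofArch (𝒟.arch.expMem (t • X))) (h.cl φ))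
      (h.cl (ρ X φ)) 0 := by
  set φ' : 𝒢.l2Representable μ := ⟨φ, h.le_l2Representable φ.2⟩
  set ψ' : 𝒢.l2Representable μ := ⟨_, h.le_l2Representable (ρ X φ).2⟩
  have hf := 𝒢.memLp_l2Rep φ'
  have hg := 𝒢.memLp_l2Rep ψ'
  have h1 : h.cl φ = hf.toLp _ := rfl
  have h2 : h.cl (ρ X φ) = hg.toLp _ := rfl
  rw [h1, h2]
  refine hasDerivAt_rightRegular_expMem_toLp 𝒟 hf hg ?_ X ?_
  · rw [𝒢.invQuot_l2Rep]
    exact h.smooth φ φ.2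
  · rw [𝒢.invQuot_l2Rep, 𝒢.invQuot_l2Rep]
    exact (hρ X φ).symm

/-- **The class-level Lie derivatives are skew-symmetric** (any datum):
`⟪[X φ], [ψ]⟫ + ⟪[φ], [X ψ]⟫ = 0` for `φ, ψ ∈ W` (differentiate the constant
`t ↦ ⟪R(exp tX)[φ], R(exp tX)[ψ]⟫` at `0`; `R` is unitary). Harish-Chandra 1953, §11; Nelson 1959,
§8. [cite: HarishChandraTAMS1953, §11 (p. 230)] -/
theorem inner_cl_lieHom_add_inner_cl_lieHom (X : 𝒟.arch.lie) (φ ψ : W) :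
    ⟪h.cl (ρ X φ), h.cl ψ⟫_ℂ + ⟪h.cl φ, h.cl (ρ X ψ)⟫_ℂ = 0 := by
  have hF := h.hasDerivAt_rightRegular_cl_lieHom ρ hρ X φ
  have hG := h.hasDerivAt_rightRegular_cl_lieHom ρ hρ X ψ
  have hFG := hF.inner ℂ hG
  have e0 : 𝒢.rightRegular μ (𝒟.ofArch (𝒟.arch.expMem ((0 : ℝ) • X))) = 1 := by
    rw [RealMatrixGroup.expMem_zero_smul, map_one, map_one]
  simp only [e0, one_apply_eq_self] at hFG
  have hconst : (fun t : ℝ ↦ ⟪𝒢.rightRegular μ (𝒟.ofArch (𝒟.arch.expMem (t • X))) (h.cl φ),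
      𝒢.rightRegular μ (𝒟.ofArch (𝒟.arch.expMem (t • X))) (h.cl ψ)⟫_ℂ) =
        fun _ ↦ ⟪h.cl φ, h.cl ψ⟫_ℂ := by
    funext t
    exact (𝒢.rightRegularIsometry μ _).inner_map_map (h.cl φ) (h.cl ψ)
  have hzero : HasDerivAt (fun t : ℝ ↦
      ⟪𝒢.rightRegular μ (𝒟.ofArch (𝒟.arch.expMem (t • X))) (h.cl φ),
        𝒢.rightRegular μ (𝒟.ofArch (𝒟.arch.expMem (t • X))) (h.cl ψ)⟫_ℂ) 0 0 := by
    rw [hconst]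
    exact hasDerivAt_const 0 _
  have huniq := hFG.unique hzero
  rwa [add_comm] at huniq

/-- **Nelson's estimate for the Lie derivatives on `W`** (any datum). Let `X₁, …, X_d ∈ 𝔤` have
brackets in their real span and let `T ≤ W` be finite-dimensional and stable under `∑ᵢ Xᵢ²`. Then
there is `M ≥ 0` with `‖[X^m φ]‖ ≤ (M ∑|xᵢ|)^m m! ‖[φ]‖` for every real combination
`X = ∑ xᵢ Xᵢ`, every `φ ∈ T` and every `m`
(`Literature.Analysis.OperatorTheory.norm_pow_sum_smul_le_of_laplacian_stable` for the operators
`ρ Xᵢ` with the inner product `⟪[·], [·]⟫`). Nelson 1959, §8; Harish-Chandra 1953, Lemma 34.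
[cite: HarishChandraTAMS1953, Lemma 34 (p. 228)] -/
theorem exists_norm_cl_lieHom_pow_le {I : Type*} [Fintype I] (Xf : I → 𝒟.arch.lie)
    (hbr : ∀ i j, ⁅Xf i, Xf j⁆ ∈ Submodule.span ℝ (Set.range Xf)) (T : Submodule ℂ W)
    [FiniteDimensional ℂ T] (hT : ∀ u ∈ T, (∑ i, ρ (Xf i) * ρ (Xf i)) u ∈ T) :
    ∃ M : ℝ, 0 ≤ M ∧ ∀ (x : I → ℝ) (φ : W), φ ∈ T → ∀ m : ℕ,
      ‖h.cl ((ρ (∑ i, x i • Xf i) ^ m) φ)‖ ≤ (M * ∑ i, |x i|) ^ m * m.factorial * ‖h.cl φ‖ := by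
  classical
  choose c hc' using fun i j ↦ (Submodule.mem_span_range_iff_exists_fun ℝ).mp (hbr i j)
  have hbr : ∀ i j, ⁅Xf i, Xf j⁆ = ∑ l, c i j l • Xf l := fun i j ↦ (hc' i j).symm
  letI : NormedAddCommGroup W := @InnerProductSpace.Core.toNormedAddCommGroup ℂ W _ _ _ h.innerCore
  letI : InnerProductSpace ℂ W := InnerProductSpace.ofCore _
  have hnorm : ∀ φ : W, ‖φ‖ = ‖h.cl φ‖ := fun φ ↦ by
    rw [@norm_eq_sqrt_re_inner ℂ, @norm_eq_sqrt_re_inner ℂ]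
    rfl
  set Af : I → Module.End ℂ W := fun i ↦ ρ (Xf i) with hAf
  have hskew : ∀ i (u w : W), ⟪Af i u, w⟫_ℂ = -⟪u, Af i w⟫_ℂ := fun i u w ↦ by
    rw [eq_neg_iff_add_eq_zero]
    exact h.inner_cl_lieHom_add_inner_cl_lieHom ρ hρ (Xf i) u w
  have hbr' : ∀ i j, Af i * Af j - Af j * Af i = ∑ l, (c i j l : ℂ) • Af l := fun i j ↦
    IsLieStableSmooth.lieHom_mul_sub_mul_eq_sum ρ hρ h.isLieStableSmooth Xf c hbr i j
  set cM : ℝ := ∑ i, ∑ j, ∑ l, |c i j l| with hcM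
  have hcM0 : 0 ≤ cM := by positivity
  have hcle : ∀ i j l, |c i j l| ≤ cM := fun i j l ↦ by
    rw [hcM]
    refine le_trans ?_ (Finset.single_le_sum (f := fun i ↦ ∑ j, ∑ l, |c i j l|)
      (fun _ _ ↦ by positivity) (Finset.mem_univ i))
    refine le_trans ?_ (Finset.single_le_sum (f := fun j ↦ ∑ l, |c i j l|)
      (fun _ _ ↦ by positivity) (Finset.mem_univ j))
    exact Finset.single_le_sum (f := fun l ↦ |c i j l|) (fun _ _ ↦ abs_nonneg _) (Finset.mem_univ l)
  have hlap : ∀ u ∈ T, Literature.Analysis.OperatorTheory.laplacian Af u ∈ T := fun u hu ↦ by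
    rw [Literature.Analysis.OperatorTheory.laplacian]
    exact hT u hu
  obtain ⟨B, hB0, hB⟩ := Literature.Analysis.OperatorTheory.exists_norm_laplacian_le Af T
  refine ⟨Real.sqrt B + 2 * (Fintype.card I : ℝ) ^ 2 * cM, by positivity, fun x φ hφ m ↦ ?_⟩
  have key := Literature.Analysis.OperatorTheory.norm_pow_sum_smul_le_of_laplacian_stable Af hskew c
    hbr' hcM0 hcle hlap hB0 hB x m hφ
  rw [hnorm, hnorm] at key
  have hsum : (∑ i, (x i : ℂ) • Af i) = ρ (∑ i, x i • Xf i) := by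
    rw [h.isLieStableSmooth.lieHom_sum_smul_eq ρ hρ]
  rwa [hsum] at key

/-- **Analytic orbits from factorial bounds** (any datum): if `‖[X^m φ]‖ ≤ C Mᵐ m!` for all `m`,
then `t ↦ R(exp tX) [φ]` is real analytic at every `t₀` (one-parameter group of isometries;
`Literature.Analysis.OperatorTheory.analyticAt_oneParam_apply_of_norm_le`). Harish-Chandra 1953,
§7, Thm. 2; Nelson 1959, Lemma 5.1. [cite: HarishChandraTAMS1953, §7, Thm. 2 (pp. 209–210)] -/
theorem analyticAt_rightRegular_cl_of_norm_lieHom_pow_le (X : 𝒟.arch.lie) (φ : W) {C M : ℝ}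
    (hb : ∀ m, ‖h.cl ((ρ X ^ m) φ)‖ ≤ C * M ^ m * m.factorial) (t₀ : ℝ) :
    AnalyticAt ℝ (fun t : ℝ ↦ 𝒢.rightRegular μ (𝒟.ofArch (𝒟.arch.expMem (t • X))) (h.cl φ)) t₀ := by
  let U : ℝ → 𝒢.L2 μ →L[ℝ] 𝒢.L2 μ := fun t ↦
    (𝒢.rightRegular μ (𝒟.ofArch (𝒟.arch.expMem (t • X)))).restrictScalars ℝ
  have hU : ∀ s t v, U (s + t) v = U s (U t v) := by
    intro s t v
    simp only [U, ContinuousLinearMap.coe_restrictScalars', RealMatrixGroup.expMem_add_smul, map_mul]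
    rfl
  have hB : ∀ t v, ‖U t v‖ ≤ 1 * ‖v‖ := fun t v ↦ by
    rw [one_mul]
    exact (𝒢.norm_rightRegular_apply μ _ v).le
  let w : ℕ → 𝒢.L2 μ := fun m ↦ h.cl ((ρ X ^ m) φ)
  have hw : ∀ m, HasDerivAt (fun t ↦ U t (w m)) (w (m + 1)) 0 := by
    intro m
    have hd := h.hasDerivAt_rightRegular_cl_lieHom ρ hρ X ((ρ X ^ m) φ)
    rw [← Module.End.mul_apply, ← pow_succ'] at hd
    exact hd
  have hmain := Literature.Analysis.OperatorTheory.analyticAt_oneParam_apply_of_norm_le U hU hB w hw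
    hb t₀
  simpa only [U, w, pow_zero, Module.End.one_apply, ContinuousLinearMap.coe_restrictScalars'] using hmain

/-- **`Δ`-finite vectors have analytic orbits** (any datum; `ρ`-form). If `X₁, …, X_d` span `𝔤`
over `ℝ`, `T ≤ W` is finite-dimensional and `∑ᵢ Xᵢ²`-stable, and `φ ∈ T`, then
`t ↦ R(exp tX) [φ]` is real analytic at every `t₀`, for every `X ∈ 𝔤`. Harish-Chandra 1953,
Lemma 34; Nelson 1959, Thm. 3 and §8. [cite: HarishChandraTAMS1953, Lemma 34 (p. 228)] -/
theorem analyticAt_rightRegular_cl_of_laplacian_stable {I : Type*} [Fintype I] (Xf : I → 𝒟.arch.lie)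
    (hXf : Submodule.span ℝ (Set.range Xf) = ⊤) (T : Submodule ℂ W) [FiniteDimensional ℂ T]
    (hT : ∀ u ∈ T, (∑ i, ρ (Xf i) * ρ (Xf i)) u ∈ T) {φ : W} (hφ : φ ∈ T)
    (X : 𝒟.arch.lie) (t₀ : ℝ) :
    AnalyticAt ℝ (fun t : ℝ ↦ 𝒢.rightRegular μ (𝒟.ofArch (𝒟.arch.expMem (t • X))) (h.cl φ)) t₀ := by
  have hbr : ∀ i j, ⁅Xf i, Xf j⁆ ∈ Submodule.span ℝ (Set.range Xf) := fun i j ↦ by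
    rw [hXf]; trivial
  obtain ⟨M, -, hM⟩ := h.exists_norm_cl_lieHom_pow_le ρ hρ Xf hbr T hT
  have hX : X ∈ Submodule.span ℝ (Set.range Xf) := by rw [hXf]; trivial
  obtain ⟨x, hx⟩ := (Submodule.mem_span_range_iff_exists_fun ℝ).mp hX
  rw [← hx]
  refine h.analyticAt_rightRegular_cl_of_norm_lieHom_pow_le ρ hρ _ φ (C := ‖h.cl φ‖)
    (M := M * ∑ i, |x i|) (fun m ↦ ?_) t₀
  calc ‖h.cl ((ρ (∑ i, x i • Xf i) ^ m) φ)‖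
      ≤ (M * ∑ i, |x i|) ^ m * m.factorial * ‖h.cl φ‖ := hM x φ hφ m
    _ = ‖h.cl φ‖ * (M * ∑ i, |x i|) ^ m * m.factorial := by ring

end IsL2LieStable

/-! ### 3. The `ρ`-free statements: `Δ`-stable and `𝔭^∓`-null finite-dimensional subspaces -/

section RhoFree

variable [FiniteDimensional ℝ A]

/-- **On a `𝔭^∓`-null function Nelson's Laplacian acts through `𝔨`.** Let `P, Q ∈ 𝔤`, `c ∈ ℂ`
with `c² = -1`, and `ψ` an archimedean-smooth function with `Q ψ = c • P ψ`. Then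
`P (P ψ) + Q (Q ψ) = -c • ⁅P, Q⁆ ψ` (`Q (Q ψ) = c Q (P ψ) = c (P (Q ψ) - ⁅P,Q⁆ ψ) = c² P (P ψ) -
c ⁅P,Q⁆ ψ`). For `𝔲(2,1) ⊃ 𝔭 ∋ X_b` and `Q = X_{ib}`, `c = i`, this is the computation
`X_b² + X_{ib}² = (X_b - iX_{ib})(X_b + iX_{ib}) - i[X_b, X_{ib}]` showing that the Casimir acts on
lowest-weight vectors through `𝔨`: Hall 2015, proof of Prop. 10.6
(`-Y_α² - Z_α² = 2 X_α^* X_α + [X_α, X_α^*]`, and `π(X_α) v = 0` on a highest weight vector).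
[cite: Hall2015, Prop. 10.6 (proof)] -/
theorem lieDeriv_lieDeriv_add_of_null (P Q : 𝒟.arch.lie) (c : ℂ) (hc : c * c = -1)
    {ψ : 𝒢.Adelic → ℂ} (hψ : IsArchSmooth 𝒟.ofArch ψ)
    (hnull : lieDeriv 𝒟.ofArch Q ψ = c • lieDeriv 𝒟.ofArch P ψ) :
    lieDeriv 𝒟.ofArch P (lieDeriv 𝒟.ofArch P ψ) + lieDeriv 𝒟.ofArch Q (lieDeriv 𝒟.ofArch Q ψ) =
      -c • lieDeriv 𝒟.ofArch ⁅P, Q⁆ ψ := by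
  have hbr := lieDeriv_bracket 𝒟.ofArch P Q hψ
  rw [hbr, hnull, lieDeriv_smul, lieDeriv_smul, smul_sub, ← mul_smul, neg_mul, hc, neg_neg, one_smul,
    neg_smul, sub_neg_eq_add]

namespace IsL2LieStable

variable [𝒢.IsAutomorphicMeasure μ] (h : IsL2LieStable 𝒟 μ W)
include h

/-- **`Δ`-finite vectors have analytic `L²`-orbits** (any automorphy datum). Let `W` be an
`L²`-Lie-stable space (`IsL2LieStable`: `𝔤`-stable, archimedean-smooth, represented by
`ℒ²`-functions, injective class map), `X₁, …, X_d` a finite family spanning `𝔤` over `ℝ`, and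
`V ≤ W` a finite-dimensional subspace with `∑ᵢ Xᵢ (Xᵢ ψ) ∈ V` for all `ψ ∈ V` ("`V` is stable
under Nelson's Laplacian"). Then for every `f ∈ ℒ²(μ)` with `invQuot f ∈ V`, every `X ∈ 𝔤` and
every `t₀ ∈ ℝ`, the orbit `t ↦ R(exp tX) [f]` is real analytic at `t₀` as a map into `L²(μ)`.
Harish-Chandra 1953, Lemma 34 (well-behaved vectors); Nelson 1959, §8 (`Δ`-finite ⇒ analytic).
[cite: HarishChandraTAMS1953, Lemma 34 (p. 228)] -/
theorem analyticAt_rightRegular_toLp_of_laplacian_stable {I : Type*} [Fintype I]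
    (Xf : I → 𝒟.arch.lie) (hXf : Submodule.span ℝ (Set.range Xf) = ⊤)
    (V : Submodule ℂ (𝒢.Adelic → ℂ)) [FiniteDimensional ℂ V] (hVW : V ≤ W)
    (hΔ : ∀ ψ ∈ V, ∑ i, lieDeriv 𝒟.ofArch (Xf i) (lieDeriv 𝒟.ofArch (Xf i) ψ) ∈ V)
    {f : 𝒢.automorphicQuotient → ℂ} (hf : MemLp f 2 μ) (hfV : invQuot 𝒢 f ∈ V)
    (X : 𝒟.arch.lie) (t₀ : ℝ) :
    AnalyticAt ℝ (fun t : ℝ ↦ 𝒢.rightRegular μ (𝒟.ofArch (𝒟.arch.expMem (t • X))) (hf.toLp f)) t₀ := by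
  obtain ⟨ρ, hρ⟩ := h.isLieStableSmooth.exists_lieHom
  -- `V` read inside `W`
  let T : Submodule ℂ W := V.comap W.subtype
  haveI : FiniteDimensional ℂ T :=
    LinearEquiv.finiteDimensional (Submodule.comapSubtypeEquivOfLe hVW).symm
  have hT : ∀ u ∈ T, (∑ i, ρ (Xf i) * ρ (Xf i)) u ∈ T := fun u hu ↦ by
    change (((∑ i, ρ (Xf i) * ρ (Xf i)) u : W) : 𝒢.Adelic → ℂ) ∈ V
    rw [IsLieStableSmooth.coe_sum_lieHom_mul_lieHom_apply ρ hρ]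
    exact hΔ _ hu
  let φ : W := ⟨invQuot 𝒢 f, hVW hfV⟩
  have hφ : φ ∈ T := hfV
  have hcl : h.cl φ = hf.toLp f := h.cl_eq_toLp hf rfl
  rw [← hcl]
  exact h.analyticAt_rightRegular_cl_of_laplacian_stable ρ hρ Xf hXf T hT hφ X t₀

/-- Matrix-coefficient form of `analyticAt_rightRegular_toLp_of_laplacian_stable`: under the same
hypotheses `t ↦ ⟪u, R(exp tX) [f]⟫` is real analytic at every `t₀`, for every `u ∈ L²(μ)` (the
hypothesis `hana` of `closure_l2OfForms_exp_invariant_of_analytic`, weak analyticity of Libine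
2012, Thm. 72). [cite: HarishChandraTAMS1953, Lemma 34 (p. 228)] -/
theorem analyticAt_inner_rightRegular_toLp_of_laplacian_stable {I : Type*} [Fintype I]
    (Xf : I → 𝒟.arch.lie) (hXf : Submodule.span ℝ (Set.range Xf) = ⊤)
    (V : Submodule ℂ (𝒢.Adelic → ℂ)) [FiniteDimensional ℂ V] (hVW : V ≤ W)
    (hΔ : ∀ ψ ∈ V, ∑ i, lieDeriv 𝒟.ofArch (Xf i) (lieDeriv 𝒟.ofArch (Xf i) ψ) ∈ V)
    {f : 𝒢.automorphicQuotient → ℂ} (hf : MemLp f 2 μ) (hfV : invQuot 𝒢 f ∈ V)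
    (X : 𝒟.arch.lie) (u : 𝒢.L2 μ) (t₀ : ℝ) :
    AnalyticAt ℝ (fun t : ℝ ↦
      ⟪u, 𝒢.rightRegular μ (𝒟.ofArch (𝒟.arch.expMem (t • X))) (hf.toLp f)⟫_ℂ) t₀ := by
  have han := h.analyticAt_rightRegular_toLp_of_laplacian_stable Xf hXf V hVW hΔ hf hfV X t₀
  have h2 := (((innerSL ℂ u).restrictScalars ℝ).analyticAt _).comp han
  simpa only [Function.comp_def, ContinuousLinearMap.coe_restrictScalars', innerSL_apply_apply] using h2

/-- **Lowest-weight (`𝔭^∓`-null) `𝔨`-finite vectors have analytic `L²`-orbits** (any automorphy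
datum; the Cauchy–Riemann route to `Δ`-finiteness). Let `𝔤` be spanned over `ℝ` by a finite
family `Y_a` together with pairs `P_b, Q_b` such that `⁅P_b, Q_b⁆ ∈ span_ℝ {Y_a}` (for a Hermitian
symmetric pair: `Y_a` a basis of `𝔨`, `P_b` a real basis of a complex structure on `𝔭` and
`Q_b = J P_b`, `[𝔭, 𝔭] ⊆ 𝔨`). Let `W` be `L²`-Lie-stable and `V ≤ W` finite-dimensional, stable
under the `Y_a`, and such that `Q_b ψ = c • P_b ψ` on `V` for a fixed `c` with `c² = -1`
(annihilation by `𝔭⁻`, resp. `𝔭⁺`). Then `V` is stable under `∑ Y_a² + ∑ (P_b² + Q_b²)`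
(`lieDeriv_lieDeriv_add_of_null`), so for `f ∈ ℒ²(μ)` with `invQuot f ∈ V` the orbit
`t ↦ R(exp tX) [f]` is real analytic at every `t₀`, for every `X ∈ 𝔤`. This is the classical fact
that holomorphic (lowest-weight, `K`-finite) vectors are analytic vectors, obtained here by
Nelson's method instead of the Casimir / elliptic-regularity route. Harish-Chandra 1953, Lemma 34;
Nelson 1959, §8; Knapp 1986, Ch. VIII §§2–3. [cite: HarishChandraTAMS1953, Lemma 34 (p. 228)] -/
theorem analyticAt_rightRegular_toLp_of_null {ιK ιP : Type*}
    [Fintype ιK] [Fintype ιP] (Y : ιK → 𝒟.arch.lie) (P Q : ιP → 𝒟.arch.lie)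
    (hspan : Submodule.span ℝ (Set.range (Sum.elim Y (Sum.elim P Q))) = ⊤)
    (hPQ : ∀ b, ⁅P b, Q b⁆ ∈ Submodule.span ℝ (Set.range Y))
    (V : Submodule ℂ (𝒢.Adelic → ℂ)) [FiniteDimensional ℂ V] (hVW : V ≤ W)
    (hVY : ∀ a, ∀ ψ ∈ V, lieDeriv 𝒟.ofArch (Y a) ψ ∈ V) (c : ℂ) (hc : c * c = -1)
    (hnull : ∀ b, ∀ ψ ∈ V, lieDeriv 𝒟.ofArch (Q b) ψ = c • lieDeriv 𝒟.ofArch (P b) ψ)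
    {f : 𝒢.automorphicQuotient → ℂ} (hf : MemLp f 2 μ) (hfV : invQuot 𝒢 f ∈ V)
    (X : 𝒟.arch.lie) (t₀ : ℝ) :
    AnalyticAt ℝ (fun t : ℝ ↦ 𝒢.rightRegular μ (𝒟.ofArch (𝒟.arch.expMem (t • X))) (hf.toLp f)) t₀ := by
  refine h.analyticAt_rightRegular_toLp_of_laplacian_stable (Sum.elim Y (Sum.elim P Q)) hspan V hVW
    (fun ψ hψ ↦ ?_) hf hfV X t₀
  have hsm : IsArchSmooth 𝒟.ofArch ψ := h.smooth ψ (hVW hψ)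
  rw [Fintype.sum_sum_type, Fintype.sum_sum_type]
  simp only [Sum.elim_inl, Sum.elim_inr]
  refine V.add_mem (V.sum_mem fun a _ ↦ hVY a _ (hVY a _ hψ)) ?_
  rw [← Finset.sum_add_distrib]
  refine V.sum_mem fun b _ ↦ ?_
  rw [lieDeriv_lieDeriv_add_of_null (P b) (Q b) c hc hsm (hnull b ψ hψ)]
  refine V.smul_mem _ ?_
  -- `⁅P_b, Q_b⁆ = ∑ r_a Y_a` acts on `ψ` through the `Y_a`
  obtain ⟨r, hr⟩ := (Submodule.mem_span_range_iff_exists_fun ℝ).mp (hPQ b)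
  rw [← hr, hsm.lieDeriv_sum_smul_left 𝒟.ofArch]
  exact V.sum_mem fun a _ ↦ V.smul_of_tower_mem _ (hVY a _ hψ)

/-- Matrix-coefficient form of `analyticAt_rightRegular_toLp_of_null`: under the same hypotheses
`t ↦ ⟪u, R(exp tX) [f]⟫` is real analytic at every `t₀` for every `u ∈ L²(μ)`.
[cite: HarishChandraTAMS1953, Lemma 34 (p. 228)] -/
theorem analyticAt_inner_rightRegular_toLp_of_null {ιK ιP : Type*}
    [Fintype ιK] [Fintype ιP] (Y : ιK → 𝒟.arch.lie) (P Q : ιP → 𝒟.arch.lie)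
    (hspan : Submodule.span ℝ (Set.range (Sum.elim Y (Sum.elim P Q))) = ⊤)
    (hPQ : ∀ b, ⁅P b, Q b⁆ ∈ Submodule.span ℝ (Set.range Y))
    (V : Submodule ℂ (𝒢.Adelic → ℂ)) [FiniteDimensional ℂ V] (hVW : V ≤ W)
    (hVY : ∀ a, ∀ ψ ∈ V, lieDeriv 𝒟.ofArch (Y a) ψ ∈ V) (c : ℂ) (hc : c * c = -1)
    (hnull : ∀ b, ∀ ψ ∈ V, lieDeriv 𝒟.ofArch (Q b) ψ = c • lieDeriv 𝒟.ofArch (P b) ψ)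
    {f : 𝒢.automorphicQuotient → ℂ} (hf : MemLp f 2 μ) (hfV : invQuot 𝒢 f ∈ V)
    (X : 𝒟.arch.lie) (u : 𝒢.L2 μ) (t₀ : ℝ) :
    AnalyticAt ℝ (fun t : ℝ ↦
      ⟪u, 𝒢.rightRegular μ (𝒟.ofArch (𝒟.arch.expMem (t • X))) (hf.toLp f)⟫_ℂ) t₀ := by
  have han := h.analyticAt_rightRegular_toLp_of_null Y P Q hspan hPQ V hVW hVY c hc hnull hf hfV X t₀
  have h2 := (((innerSL ℂ u).restrictScalars ℝ).analyticAt _).comp han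
  simpa only [Function.comp_def, ContinuousLinearMap.coe_restrictScalars', innerSL_apply_apply] using h2

end IsL2LieStable

end RhoFree

end Literature.NumberTheory.Automorphic
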